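import Mathlib
import Literature.NumberTheory.LFunctions.FeketePolynomial

/-!
# `FeketeSOS.FeketeSOSHard` (stmt-ValiantsHypothesis-3996), line `Sketch` — stub `stub_goodReductionTransfer`

The vehicle of the line (GOOD-REDUCTION TRANSFER).  A complex weighted-SOS representation
`Σ_i c_i g_i² = F_p` of the Fekete polynomial all of whose weights `c_i` and all of whose coefficients
of the `g_i` lie in a subring `O ⊆ ℂ` admitting a ring map `φ : O →+* k` to a field `k` of
characteristic `p` is

1. lifted to `O[X]` (`Polynomial.toSubring`; the identity survives because `Polynomial.map O.subtype`
   is injective and `F_p` has integer coefficients),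
2. pushed along `φ` to `k[X]`: `Σ_i φ(c_i) h_i² = F̄_p` with `h_i = φ(g_i)`, `supp h_i ⊆ supp g_i`,
3. folded cyclically: every `h ∈ k[X]` is congruent modulo `X^p - 1` to its fold
   `Σ_{n ∈ supp h} h_n X^{n mod p}`, which has degree `< p` and no more monomials than `h`.

With `B_j` the fold of `h_j` and `A_j = φ(c_j) · B_j` one gets `X^p - 1 ∣ Σ_j A_j B_j - F̄_p` with
`deg A_j, deg B_j < p` and `|supp A_j|, |supp B_j| ≤ |supp g_j|`.
-/

namespace Summit.ValiantsHypothesis.ValiantsHypothesis.Theorems.FeketeSOSHardSketch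

open Polynomial
open Literature.NumberTheory.LFunctions

-- `Summit.ValiantsHypothesis.ValiantsHypothesis.…` is the tree's mandated single-conjunct layout (Sub = Summit).
set_option linter.dupNamespace false

section Fold

variable {k : Type*} [CommRing k]

/-- The cyclic fold `Σ_{n ∈ supp f} f_n X^{n mod p}` has no more monomials than `f`: its support lies
in the image of `supp f` under `n ↦ n mod p`. -/
theorem grt_card_support_fold_le (f : k[X]) (p : ℕ) :
    (∑ n ∈ f.support, C (f.coeff n) * X ^ (n % p)).support.card ≤ f.support.card := by
  classical
  calc (∑ n ∈ f.support, C (f.coeff n) * X ^ (n % p)).support.card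
      ≤ (f.support.image fun n => n % p).card := by
        refine Finset.card_le_card fun m hm => ?_
        rw [mem_support_iff, finsetSum_coeff] at hm
        obtain ⟨n, hn, hne⟩ := Finset.exists_ne_zero_of_sum_ne_zero hm
        rw [coeff_C_mul, coeff_X_pow] at hne
        refine Finset.mem_image.mpr ⟨n, hn, ?_⟩
        by_contra h
        exact hne (by rw [if_neg (Ne.symm h), mul_zero])
    _ ≤ f.support.card := Finset.card_image_le

/-- The cyclic fold has degree `< p` (for `0 < p`). -/
theorem grt_natDegree_fold_lt (f : k[X]) {p : ℕ} (hp : 0 < p) :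
    (∑ n ∈ f.support, C (f.coeff n) * X ^ (n % p)).natDegree < p := by
  refine lt_of_le_of_lt (natDegree_sum_le_of_forall_le (n := p - 1) f.support _ fun n _ => ?_)
    (Nat.sub_lt hp one_pos)
  refine (natDegree_C_mul_X_pow_le (f.coeff n) (n % p)).trans ?_
  have := Nat.mod_lt n hp
  omega

/-- `X^p - 1 ∣ X^{n mod p} - X^n`. -/
theorem grt_X_pow_sub_one_dvd_X_pow_mod_sub (p n : ℕ) :
    (X : k[X]) ^ p - 1 ∣ X ^ (n % p) - X ^ n := by
  have h : (X : k[X]) ^ n = X ^ (n % p) * (X ^ p) ^ (n / p) := by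
    rw [← pow_mul, ← pow_add, Nat.mod_add_div]
  have h2 : (X : k[X]) ^ (n % p) - X ^ n = - (X ^ (n % p) * ((X ^ p) ^ (n / p) - 1 ^ (n / p))) := by
    rw [h]; ring
  rw [h2, dvd_neg]
  exact Dvd.dvd.mul_left (sub_dvd_pow_sub_pow ((X : k[X]) ^ p) 1 (n / p)) _

/-- The cyclic fold of `f` is congruent to `f` modulo `X^p - 1`. -/
theorem grt_X_pow_sub_one_dvd_fold_sub (f : k[X]) (p : ℕ) :
    (X : k[X]) ^ p - 1 ∣ (∑ n ∈ f.support, C (f.coeff n) * X ^ (n % p)) - f := by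
  have h : (∑ n ∈ f.support, C (f.coeff n) * X ^ (n % p)) - f
      = ∑ n ∈ f.support, C (f.coeff n) * (X ^ (n % p) - X ^ n) := by
    simp only [mul_sub, Finset.sum_sub_distrib, ← as_sum_support_C_mul_X_pow]
  rw [h]
  exact Finset.dvd_sum fun n _ => Dvd.dvd.mul_left (grt_X_pow_sub_one_dvd_X_pow_mod_sub p n) _

/-- The support of `C a * f` lies in the support of `f`. -/
theorem grt_support_C_mul_subset (a : k) (f : k[X]) : (C a * f).support ⊆ f.support := fun n hn => by
  rw [mem_support_iff] at hn ⊢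
  rw [coeff_C_mul] at hn
  exact right_ne_zero_of_mul hn

/-- **Assembly modulo `X^p - 1`**: if `Σ_i a_i h_i² = F` and `B_j ≡ h_j (mod X^p - 1)`, then
`Σ_j (a_j B_j) B_j ≡ F (mod X^p - 1)`. -/
theorem grt_dvd_sum_mul_sub {p s : ℕ} (a : Fin s → k) (h B : Fin s → k[X]) (F : k[X])
    (hrep : ∑ i, C (a i) * h i ^ 2 = F) (hB : ∀ j, (X : k[X]) ^ p - 1 ∣ B j - h j) :
    (X : k[X]) ^ p - 1 ∣ (∑ j, (C (a j) * B j) * B j) - F := by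
  rw [← hrep, ← Finset.sum_sub_distrib]
  refine Finset.dvd_sum fun j _ => ?_
  have e : C (a j) * B j * B j - C (a j) * h j ^ 2 = C (a j) * (B j + h j) * (B j - h j) := by ring
  rw [e]
  exact Dvd.dvd.mul_left (hB j) _

end Fold

/-- **Good-reduction transfer (the vehicle).**  A complex representation `Σ_i c_i g_i² = F_p` all of
whose coefficients lie in a subring `O ⊆ ℂ` that maps to a field `k` of characteristic `p` yields, in `k[X]`,
a CYCLIC representation `X^p - 1 ∣ Σ_j A_j B_j - F̄_p` by `s` products of polynomials of degree `< p` with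
`|supp A_j|, |supp B_j| ≤ |supp g_j|` (push the identity along `O → k`, then reduce exponents mod `p`). -/
theorem stub_goodReductionTransfer :
    ∀ (p : ℕ) [Fact p.Prime] (s : ℕ) (c : Fin s → ℂ) (g : Fin s → ℂ[X]),
      (∃ (O : Subring ℂ) (k : Type) (_ : Field k) (_ : CharP k p) (_ : O →+* k),
        (∀ i, c i ∈ O) ∧ (∀ i n, (g i).coeff n ∈ O)) →
      (∑ i, C (c i) * g i ^ 2) = (feketePolynomial p).map (Int.castRingHom ℂ) →
      ∃ (k : Type) (_ : Field k) (_ : CharP k p) (A B : Fin s → k[X]),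
        (∀ j, (A j).natDegree < p ∧ (B j).natDegree < p) ∧
        (∀ j, (A j).support.card ≤ (g j).support.card ∧ (B j).support.card ≤ (g j).support.card) ∧
        ((X : k[X]) ^ p - 1 ∣ (∑ j, A j * B j) - (feketePolynomial p).map (Int.castRingHom k)) := by
  intro p _ s c g hgood hrep
  obtain ⟨O, k, hk, hchar, φ, hc, hg⟩ := hgood
  classical
  have hp0 : 0 < p := (Fact.out : p.Prime).pos
  -- (1) lift the weights and the polynomials to `O` and `O[X]`
  obtain ⟨c', hc'⟩ : ∃ c' : Fin s → O, ∀ i, (c' i : ℂ) = c i := ⟨fun i => ⟨c i, hc i⟩, fun i => rfl⟩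
  have hcoeffs : ∀ i, (↑(g i).coeffs : Set ℂ) ⊆ O := fun i a ha => by
    obtain ⟨n, -, rfl⟩ := Polynomial.mem_coeffs_iff.mp ha
    exact hg i n
  obtain ⟨g', hg'map, hg'supp⟩ :
      ∃ g' : Fin s → O[X], (∀ i, (g' i).map O.subtype = g i) ∧ (∀ i, (g' i).support = (g i).support) :=
    ⟨fun i => (g i).toSubring O (hcoeffs i), fun i => map_toSubring _ _ _,
      fun i => support_toSubring _ _ _⟩
  -- the Fekete polynomial pushed along `ℤ → R → S` is the Fekete polynomial pushed along `ℤ → S`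
  have hFmap : ∀ (R S : Type) [CommRing R] [CommRing S] (f : R →+* S),
      ((feketePolynomial p).map (Int.castRingHom R)).map f
        = (feketePolynomial p).map (Int.castRingHom S) := fun R S _ _ f => by
    rw [Polynomial.map_map, RingHom.ext_int (f.comp (Int.castRingHom R)) (Int.castRingHom S)]
  -- (2) the identity in `O[X]` (injectivity of `map O.subtype`)
  have hrepO : (∑ i, C (c' i) * g' i ^ 2) = (feketePolynomial p).map (Int.castRingHom O) := by
    apply Polynomial.map_injective O.subtype O.subtype_injective
    rw [hFmap O ℂ O.subtype, ← hrep, Polynomial.map_sum]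
    refine Finset.sum_congr rfl fun i _ => ?_
    rw [Polynomial.map_mul, Polynomial.map_pow, map_C, hg'map i, Subring.subtype_apply, hc' i]
  -- (3) push along `φ`
  obtain ⟨h, hh⟩ : ∃ h : Fin s → k[X], ∀ i, h i = (g' i).map φ := ⟨_, fun _ => rfl⟩
  have hrepk : (∑ i, C (φ (c' i)) * h i ^ 2) = (feketePolynomial p).map (Int.castRingHom k) := by
    rw [← hFmap O k φ, ← hrepO, Polynomial.map_sum]
    refine Finset.sum_congr rfl fun i _ => ?_
    rw [Polynomial.map_mul, Polynomial.map_pow, map_C, hh i]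
  have hhsupp : ∀ i, (h i).support.card ≤ (g i).support.card := fun i => by
    rw [← hg'supp i, hh i]
    exact Finset.card_le_card (support_map_subset _ _)
  -- (4) fold cyclically and (5) assemble
  obtain ⟨B, hB⟩ : ∃ B : Fin s → k[X], ∀ j, B j = ∑ n ∈ (h j).support, C ((h j).coeff n) * X ^ (n % p) :=
    ⟨_, fun _ => rfl⟩
  have hBdeg : ∀ j, (B j).natDegree < p := fun j => by
    rw [hB j]; exact grt_natDegree_fold_lt (h j) hp0
  have hBsupp : ∀ j, (B j).support.card ≤ (g j).support.card := fun j => by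
    rw [hB j]; exact (grt_card_support_fold_le (h j) p).trans (hhsupp j)
  have hBdvd : ∀ j, (X : k[X]) ^ p - 1 ∣ B j - h j := fun j => by
    rw [hB j]; exact grt_X_pow_sub_one_dvd_fold_sub (h j) p
  refine ⟨k, hk, hchar, fun j => C (φ (c' j)) * B j, B, fun j => ⟨?_, hBdeg j⟩,
    fun j => ⟨?_, hBsupp j⟩, ?_⟩
  · exact lt_of_le_of_lt (natDegree_C_mul_le _ _) (hBdeg j)
  · exact (Finset.card_le_card (grt_support_C_mul_subset _ _)).trans (hBsupp j)
  · exact grt_dvd_sum_mul_sub (fun j => φ (c' j)) h B _ hrepk hBdvd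

end Summit.ValiantsHypothesis.ValiantsHypothesis.Theorems.FeketeSOSHardSketch
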